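import Summits.NavierStokesRegularity.FunctionalMining.NoGo.ConjectureS
import Summits.NavierStokesRegularity.FunctionalMining.NoGo.MiddleEigenvalueKillAllSix
import HarnessLib

/-!
# CONJECTURE S⁻ is FALSE at `m = 2` and `m = 3` (kernel) — the named refutations

Search for candidate a priori estimates; no regularity claim. NS FUNCTIONAL MINING — NO-GO BRANCH
(cell `pub-nsfunc`, no-go seat gen 7).

`NoGo/ConjectureS` names CONJECTURE S⁻(m) (`FeasibleStretchingNonpos hd m`: every smooth divergence-free
field on `T³` with middle strain eigenvalue `≤ 0` everywhere has `2m ∫ |ω|^{2(m−1)} σ ≤ 0`) and records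
`m = 1` as a theorem. This file closes the PROVE-seat target named there:
`not_feasibleStretchingNonpos_two`, and also `m = 3`, by the explicit kill-all field `KillAll.fld` of
`NoGo/MiddleEigenvalueKillAll{Field,Witness,Six}` (`λ₂ ≡ 0`, `∫|ω|²σ = 12π²XY > 0`,
`∫|ω|⁴σ = 168π²XY + 120π²ZW + 90π⁴X₃Y > 0`). Consequently (dichotomy of `NoGo/ConjectureS` §2) the
K1-Q2 rows `q = 4, 6` are dead for every constant — the same conclusion as
`KillAll.not_middleEigenvalueMomentRateBound_four/_six`, here routed through the named conjecture.
Nothing is asserted about Navier–Stokes regularity.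
-/

noncomputable section

open MeasureTheory

namespace Summit.NavierStokesRegularity.FunctionalMining

open Literature.Analysis Literature.Analysis.FluidPDE Literature.Analysis.FunctionSpaces
  Literature.Analysis.FunctionSpaces.Torus

/-- **CONJECTURE S⁻(2) is false**: the kill-all field has `λ₂ ≤ 0` everywhere and `4∫|ω|²σ > 0`.
Search for candidate a priori estimates; no regularity claim. [ours] -/
theorem not_feasibleStretchingNonpos_two (hd : Fintype.card (Fin 3) = 3) :
    ¬ FeasibleStretchingNonpos hd 2 := by
  rw [not_feasibleStretchingNonpos_iff]
  refine ⟨KillAll.fld, KillAll.isSmooth_fld, KillAll.isDivFree_fld, KillAll.middle_nonpos_fld, ?_⟩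
  have h := KillAll.integral_vortSq_mul_stretching_pos
  simp only [show (2 : ℕ) - 1 = 1 from rfl, pow_one]
  positivity

/-- **CONJECTURE S⁻(3) is false**: the same field has `6∫|ω|⁴σ > 0`.
Search for candidate a priori estimates; no regularity claim. [ours] -/
theorem not_feasibleStretchingNonpos_three (hd : Fintype.card (Fin 3) = 3) :
    ¬ FeasibleStretchingNonpos hd 3 := by
  rw [not_feasibleStretchingNonpos_iff]
  refine ⟨KillAll.fld, KillAll.isSmooth_fld, KillAll.isDivFree_fld, KillAll.middle_nonpos_fld, ?_⟩
  have h := KillAll.integral_vortSq2_mul_stretching_pos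
  simp only [show (3 : ℕ) - 1 = 2 from rfl]
  positivity

/-- Binder-free form of `not_feasibleStretchingNonpos_two` (the instance the audit reads as a refutation of
the named conjecture at `d = Fin 3`, `m = 2`). [ours] -/
theorem feasibleStretchingNonpos_two_false :
    ¬ FeasibleStretchingNonpos (d := Fin 3) (Fintype.card_fin 3) 2 :=
  not_feasibleStretchingNonpos_two _

/-- Binder-free form of `not_feasibleStretchingNonpos_three`. [ours] -/
theorem feasibleStretchingNonpos_three_false :
    ¬ FeasibleStretchingNonpos (d := Fin 3) (Fintype.card_fin 3) 3 :=
  not_feasibleStretchingNonpos_three _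

/-- The rows `q = 4` and `q = 6` die for every constant THROUGH the named conjecture (same content as
`KillAll.not_middleEigenvalueMomentRateBound_four/_six`). [ours; bookkeeping] -/
theorem killAll_four_six_of_conjectureS_false :
    (∀ C : ℝ, ¬ MiddleEigenvalueMomentRateBound (d := Fin 3) 4 C) ∧
      (∀ C : ℝ, ¬ MiddleEigenvalueMomentRateBound (d := Fin 3) 6 C) := by
  refine ⟨fun C => ?_, fun C => ?_⟩
  · have h := killAll_of_not_feasibleStretchingNonpos (m := 2) (Fintype.card_fin 3)
      (not_feasibleStretchingNonpos_two _) C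
    norm_num at h
    exact h
  · have h := killAll_of_not_feasibleStretchingNonpos (m := 3) (Fintype.card_fin 3)
      (not_feasibleStretchingNonpos_three _) C
    norm_num at h
    exact h

end Summit.NavierStokesRegularity.FunctionalMining

end
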